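import Mathlib.Data.Fin.Tuple.Sort
import Literature.MathematicalPhysics.QuantumLattice.XXXBetheVectorTransport
import HarnessLib

/-!
# The nested Bethe-ansatz wave function of the Hubbard chain: Schrödinger equation and periodicity

Trunk T-QLATTICE, topic `MathematicalPhysics/QuantumLattice`. The coordinate part of the
Bethe-ansatz eigenvector theorem of E. H. Lieb, F. Y. Wu, PRL 20 (1968) 1445, eqs. (3)–(11), in
the complete form of F. H. L. Essler, H. Frahm, F. Göhmann, A. Klümper, V. E. Korepin, *The
One-Dimensional Hubbard Model* (CUP 2005), §3.1 (3.14)–(3.17), §3.3 (3.90)–(3.96) and App. 3.B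
(held: `book:essler2005-one-dimensional-hubbard-model`, PDF pp. 81–82, 94–95, 105–123), built on
the algebraic Bethe ansatz of `XXXAlgebraicBetheAnsatz.lean` and `XXXBetheVectorTransport.lean`.
All statements are proved; no named facts. This is the third part of census item (1) of node F2c
of `lieb_wu` (module docstring of `LiebWuBetheAnsatz.lean`); the transfer to the Fock space of the
ring `hubbardChain L` (via `FockFirstQuantization.lean`) is the remaining assembly step.

## The wave function

For `N` labelled electrons with positions `x : Fin N → ℤ` and spins `a : Fin N → Fin 2`, charge
momenta `k : Fin N → ℂ`, spin rapidities `λ⃗ : List ℂ` and coupling `u` (`η = 2iu`,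
`HubbardBA.eta`), Essler's (3.B.90)
`ψ(x; a) = Σ_{P} sign(PQ) ⟨aQ | kP, λ⃗⟩ e^{i⟨kP, xQ⟩}` (`x` in the closed sector of `Q`) is
rewritten with `R = PQ⁻¹` as `ψ_c(x; a) = Σ_R sign(R) e^{i Σ_j k_{R j} x_j} ⟨a | 𝔅_c(λ⃗)|0⟩`
(`HubbardBA.psiOrd`), where the auxiliary spin chain `c` IS the list of electrons ordered by
decreasing position (Essler's sites `N, …, 1`; `HubbardBA.chain`), electron `i` carrying the
inhomogeneity `sin k_{R i} + iu` (`HubbardBA.inhom`) and its own spin `a i`; the amplitudes are the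
components of the algebraic Bethe vector `𝔅(λ₁)⋯𝔅(λ_M)|0⟩` of that chain (`HubbardBA.amp`,
(3.B.75)). `HubbardBA.psi` evaluates `ψ_c` with the canonical ordering `canon x` (Mathlib's
`Tuple.sort`); `psi_eq_psiOrd` shows that ANY ordering non-increasing in position gives the same
value — the uniqueness of the wave function on the sector boundaries, Essler (3.B.16)–(3.B.19),
here DERIVED from the exchange relation (3.B.31) (`InhomXXX.swapR_mulVec_bString_vac`) and the
relabelling invariance (`InhomXXX.bString_vac_relabel`) through `psiOrd_swap_of_tie` ((3.B.29))
and a bubble-sort induction (`psiOrd_eq_of_sorted`).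

## Main results

* `HubbardBA.schrodinger` — **the Schrödinger equation (3.16) on `ℤ^N`**: for every `(x, a)`
  with pairwise distinct (position, spin) labels (the configurations that matter for fermions),
  `-Σ_j (ψ(x+e_j; a) + ψ(x-e_j; a)) + 4u D(x) ψ(x; a) = -2(Σ_j cos k_j) ψ(x; a)`, `D(x)` the
  number of doubly occupied sites (`tiedCount` along the canonical ordering). It holds for ALL
  `λ⃗` and needs only the genericity `sin k_i - sin k_j + 2iu ≠ 0` (automatic for real `k` and real
  `u ≠ 0`); proof: the free equation for each `ψ_c` (`psiOrd_free`, (3.B.4)–(3.B.6)), the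
  classification of the moves at a doubly occupied site and the pair identity `psiOrd_pair`
  ((3.B.21)–(3.B.22), whose algebraic core `pair_core` is where `η = 2iu` enters), assembled by an
  induction over the blocks of the ordering (`block_sum`).
* `HubbardBA.psi_periodic` — **the periodic boundary condition (3.17)**: under the Lieb–Wu
  equations (spin part (3.96) as the divided Bethe equations of the chain of all electrons with
  inhomogeneities `sin k_j + iu`; charge part (3.95) as
  `e^{ik_jL} ∏_μ (sin k_j - μ - iu)/(sin k_j - μ + iu) = 1`), translating the leftmost electron by
  `L` past all others leaves `ψ` unchanged (`psiOrd_cycle` = Essler (3.B.41) solved by the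
  transfer-matrix eigenvalue (3.B.85), i.e. `InhomXXX.bString_vac_cycle`).
* `HubbardBA.psi_eq_zero_of_downCount` — `ψ(x; a) = 0` unless `a` has exactly `M` down spins.

## Conventions

Spins `0 = ↑`, `1 = ↓`; `u = U/(4t)`; positions in `ℤ` (the ring enters only through `L` in the
periodicity); `k, λ⃗, u` complex (no reality needed). Orderings are `List (Fin N)` in DEcreasing
position; ties (doubly occupied sites) may be ordered either way (`psiOrd_swap_of_tie`).

## Not in this file

Antisymmetry (3.B.94) and the symmetries (3.B.95)–(3.B.96) (not needed for the eigenvector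
theorem via `FirstQuant.slater`, which antisymmetrises automatically), the `SU(2)` and `η`-pairing
properties (App. 3.D, 3.F), explicit amplitudes (App. 3.E), norms (§3.5), and the assembly on the
Fock space of `hubbardChain L` (next file).
-/

noncomputable section

open Matrix Complex Finset

namespace Literature.MathematicalPhysics.QuantumLattice

namespace HubbardBA

open InhomXXX

variable {N : ℕ}

/-! ### The nested Bethe-ansatz wave function -/

/-- The crossing parameter `η = 2iu` of the spin problem of the Hubbard chain (`u = U/4t`).
[cite: EsslerEtAl2005, eq. (3.B.32)] -/
def eta (u : ℂ) : ℂ := 2 * I * u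

/-- The inhomogeneous spin chain on a list `c` of electrons (the electrons in DEcreasing order of
position, i.e. Essler's sites `N, N-1, …, 1`), electron `i` carrying the inhomogeneity
`t i + iu`. [cite: EsslerEtAl2005, eq. (3.B.62)] -/
def chain (u : ℂ) (c : List (Fin N)) (t : Fin N → ℂ) : List (Fin N × ℂ) :=
  c.map fun i => (i, t i + I * u)

/-- The spin amplitudes `⟨a | 𝔅(λ₁)⋯𝔅(λ_M) |0⟩` of the chain `c` with inhomogeneities `t`.
[cite: EsslerEtAl2005, eqs. (3.B.28), (3.B.75)] -/
def amp (u : ℂ) (lams : List ℂ) (c : List (Fin N)) (t : Fin N → ℂ) : (Fin N → Fin 2) → ℂ :=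
  bString (eta u) (chain u c t) lams *ᵥ vac

/-- The inhomogeneities when electron `i` carries the charge momentum `k (R i)`: `sin k_{R(i)}`.
[cite: EsslerEtAl2005, eq. (3.B.30)] -/
def inhom (k : Fin N → ℂ) (R : Equiv.Perm (Fin N)) : Fin N → ℂ := fun i => Complex.sin (k (R i))

/-- The plane wave `exp(i Σ_j k_{R(j)} x_j)`. [cite: EsslerEtAl2005, eq. (3.B.10)] -/
def planeWave (k : Fin N → ℂ) (R : Equiv.Perm (Fin N)) (x : Fin N → ℤ) : ℂ :=
  Complex.exp (I * ∑ j, k (R j) * (x j : ℂ))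

/-- The Bethe-ansatz wave function of an ordering `c` of the electrons (Essler et al. (3.B.90) in
the form `ψ(x; a) = Σ_R sign(R) e^{i⟨kR, x⟩} ⟨a | kR⟩_c`, the electron at Essler's site `m` of the
auxiliary spin chain being `c`'s `m`-th electron from the right; valid in the closed sector where
the positions are non-increasing along `c`). [cite: EsslerEtAl2005, eq. (3.B.90)] -/
def psiOrd (u : ℂ) (k : Fin N → ℂ) (lams : List ℂ) (c : List (Fin N)) (x : Fin N → ℤ)
    (a : Fin N → Fin 2) : ℂ :=
  ∑ R : Equiv.Perm (Fin N), ((Equiv.Perm.sign R : ℤ) : ℂ) * planeWave k R x * amp u lams c (inhom k R) a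

/-- The canonical ordering of the electrons by decreasing position (ties broken by the label):
the reverse of Mathlib's `Tuple.sort`. [folklore] -/
def canon (x : Fin N → ℤ) : List (Fin N) := (List.ofFn (Tuple.sort x)).reverse

/-- **The nested Bethe-ansatz wave function of the Hubbard chain** on the infinite lattice `ℤ`,
`ψ(x; a | k; λ⃗)` (Essler et al. (3.B.90) = (3.91)), as a function of the positions
`x : Fin N → ℤ` and spins `a : Fin N → Fin 2` of `N` labelled electrons.
[cite: EsslerEtAl2005, eqs. (3.91), (3.B.90)] -/
def psi (u : ℂ) (k : Fin N → ℂ) (lams : List ℂ) (x : Fin N → ℤ) (a : Fin N → Fin 2) : ℂ :=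
  psiOrd u k lams (canon x) x a

/-! ### Elementary properties of the chain lists -/

/-- The chain of a concatenated ordering. [folklore] -/
theorem chain_append (u : ℂ) (c₁ c₂ : List (Fin N)) (t : Fin N → ℂ) :
    chain u (c₁ ++ c₂) t = chain u c₁ t ++ chain u c₂ t := by
  simp [chain]

/-- The chain of an ordering with a new top electron. [folklore] -/
theorem chain_cons (u : ℂ) (i : Fin N) (c : List (Fin N)) (t : Fin N → ℂ) :
    chain u (i :: c) t = (i, t i + I * u) :: chain u c t := rfl

/-- The empty chain. [folklore] -/
theorem chain_nil (u : ℂ) (t : Fin N → ℂ) : chain u ([] : List (Fin N)) t = [] := rfl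

/-- The sites of the chain are the electrons of the ordering. [folklore] -/
theorem map_fst_chain (u : ℂ) (c : List (Fin N)) (t : Fin N → ℂ) :
    (chain u c t).map Prod.fst = c := by
  simp [chain, Function.comp_def]

/-- The chain list only depends on the inhomogeneities of its own electrons. [folklore] -/
theorem chain_congr (u : ℂ) (c : List (Fin N)) {t t' : Fin N → ℂ} (h : ∀ i ∈ c, t i = t' i) :
    chain u c t = chain u c t' := by
  unfold chain
  exact List.map_congr_left fun i hi => by rw [h i hi]

/-- Relabelling two electrons `p, q` outside `c` leaves the chain list on `c` unchanged. [folklore] -/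
theorem chain_map_swap (u : ℂ) (c : List (Fin N)) (t : Fin N → ℂ) {p q : Fin N} (hp : p ∉ c)
    (hq : q ∉ c) : (chain u c t).map (Prod.map (Equiv.swap p q) id) = chain u c t := by
  unfold chain
  rw [List.map_map]
  refine List.map_congr_left fun i hi => ?_
  simp only [Function.comp_apply, Prod.map_apply, id]
  rw [Equiv.swap_apply_of_ne_of_ne (ne_of_mem_of_not_mem hi hp) (ne_of_mem_of_not_mem hi hq)]

/-! ### The two-electron relations: Yang's `Y`-operator (3.B.31) and relabelling -/

section Pair

variable (u : ℂ) (lams : List ℂ) (c₁ c₂ : List (Fin N)) (p q : Fin N) (t : Fin N → ℂ)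
  (hnd : (c₁ ++ q :: p :: c₂).Nodup)
include hnd

/-- **Yang's relation between the two orderings of a pair** (Essler et al. (3.B.31) in cleared
form): with `d = t_p - t_q`,
`(d + η) ⟨b | c₁ p q c₂⟩ = d ⟨b | c₁ q p c₂⟩ + η ⟨b ∘ (pq) | c₁ q p c₂⟩`.
[cite: EsslerEtAl2005, eqs. (3.B.31)–(3.B.32)] -/
theorem amp_swap_order (b : Fin N → Fin 2) :
    (t p - t q + eta u) * amp u lams (c₁ ++ p :: q :: c₂) t b =
      (t p - t q) * amp u lams (c₁ ++ q :: p :: c₂) t b +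
        eta u * amp u lams (c₁ ++ q :: p :: c₂) t (b ∘ Equiv.swap p q) := by
  have hpq : p ≠ q := by
    intro h
    rw [h, List.nodup_append] at hnd
    exact (List.nodup_cons.1 hnd.2.1).1 (List.mem_cons_self)
  have hnd' : ((chain u c₁ t ++ (p, t p + I * u) :: (q, t q + I * u) :: chain u c₂ t).map
      Prod.fst).Nodup := by
    have : (chain u (c₁ ++ p :: q :: c₂) t).map Prod.fst = c₁ ++ p :: q :: c₂ := map_fst_chain u _ t
    rw [chain_append, chain_cons, chain_cons] at this
    rw [this]
    have hperm : (c₁ ++ q :: p :: c₂).Perm (c₁ ++ p :: q :: c₂) :=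
      List.Perm.append_left c₁ (List.Perm.swap p q c₂)
    exact hperm.nodup_iff.1 hnd
  have key := swapR_mulVec_bString_vac (eta u) (chain u c₁ t) (chain u c₂ t) hnd' lams
  have key' := congr_fun key b
  rw [Pi.smul_apply, add_mulVec, Pi.add_apply, smul_mulVec, smul_mulVec, one_mulVec, Pi.smul_apply,
    Pi.smul_apply, swapOp_mulVec_apply hpq, smul_eq_mul, smul_eq_mul, smul_eq_mul] at key'
  have hl1 : chain u c₁ t ++ (q, t q + I * u) :: (p, t p + I * u) :: chain u c₂ t =
      chain u (c₁ ++ q :: p :: c₂) t := by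
    rw [chain_append, chain_cons, chain_cons]
  have hl2 : chain u c₁ t ++ (p, t p + I * u) :: (q, t q + I * u) :: chain u c₂ t =
      chain u (c₁ ++ p :: q :: c₂) t := by
    rw [chain_append, chain_cons, chain_cons]
  rw [hl1, hl2] at key'
  unfold amp
  rw [show t p - t q = t p + I * u - (t q + I * u) by ring]
  linear_combination key'.symm

/-- **Relabelling the pair**: exchanging the inhomogeneities of `p` and `q` is the same as
exchanging their order and their spins, `⟨b | c₁ q p c₂⟩_{t ∘ (pq)} = ⟨b ∘ (pq) | c₁ p q c₂⟩_t`.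
[cite: EsslerEtAl2005, eqs. (3.B.24)–(3.B.28)] -/
theorem amp_swap_inhom (b : Fin N → Fin 2) :
    amp u lams (c₁ ++ q :: p :: c₂) (t ∘ Equiv.swap p q) b =
      amp u lams (c₁ ++ p :: q :: c₂) t (b ∘ Equiv.swap p q) := by
  rw [List.nodup_append] at hnd
  obtain ⟨-, hnd2, hdis⟩ := hnd
  have hq1 : q ∉ c₁ := fun h => hdis q h q List.mem_cons_self rfl
  have hp1 : p ∉ c₁ := fun h => hdis p h p (List.mem_cons_of_mem _ List.mem_cons_self) rfl
  rw [List.nodup_cons, List.mem_cons, not_or] at hnd2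
  obtain ⟨⟨hqp, hq2⟩, hnd3⟩ := hnd2
  have hp2 : p ∉ c₂ := (List.nodup_cons.1 hnd3).1
  unfold amp
  have hrel : (bString (eta u) ((chain u (c₁ ++ p :: q :: c₂) t).map (Prod.map (Equiv.swap p q) id))
      lams *ᵥ vac) b = (bString (eta u) (chain u (c₁ ++ p :: q :: c₂) t) lams *ᵥ vac) (b ∘ Equiv.swap p q) :=
    bString_vac_relabel (Equiv.swap p q) (eta u) (chain u (c₁ ++ p :: q :: c₂) t) lams b
  rw [← hrel]
  congr 2
  rw [chain_append, chain_append, chain_cons, chain_cons, chain_cons, chain_cons, List.map_append,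
    List.map_cons, List.map_cons, chain_map_swap u c₁ t hp1 hq1, chain_map_swap u c₂ t hp2 hq2]
  simp only [Prod.map_apply, id, Equiv.swap_apply_left, Equiv.swap_apply_right, Function.comp_apply]
  rw [chain_congr u c₁ (t := t ∘ Equiv.swap p q) (t' := t), chain_congr u c₂ (t := t ∘ Equiv.swap p q)
    (t' := t)]
  · intro i hi
    simp only [Function.comp_apply]
    rw [Equiv.swap_apply_of_ne_of_ne (ne_of_mem_of_not_mem hi hp2) (ne_of_mem_of_not_mem hi hq2)]
  · intro i hi
    simp only [Function.comp_apply]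
    rw [Equiv.swap_apply_of_ne_of_ne (ne_of_mem_of_not_mem hi hp1) (ne_of_mem_of_not_mem hi hq1)]

/-- `B - A = η/(d + η) · (P A - A)`: the difference of the amplitudes of the two orderings.
[cite: EsslerEtAl2005, eq. (3.B.31)] -/
theorem amp_order_diff (hd : t p - t q + eta u ≠ 0) (b : Fin N → Fin 2) :
    amp u lams (c₁ ++ p :: q :: c₂) t b - amp u lams (c₁ ++ q :: p :: c₂) t b =
      eta u / (t p - t q + eta u) *
        (amp u lams (c₁ ++ q :: p :: c₂) t (b ∘ Equiv.swap p q) - amp u lams (c₁ ++ q :: p :: c₂) t b) := by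
  have h := amp_swap_order u lams c₁ c₂ p q t hnd b
  field_simp
  linear_combination h

/-- Exchanging the inhomogeneities of a pair does not change the difference of the amplitudes of
its two orderings (`B' - A' = B - A`, the content of Essler et al. (3.B.29)).
[cite: EsslerEtAl2005, eq. (3.B.29)] -/
theorem amp_order_diff_swap_inhom (hd : t p - t q + eta u ≠ 0) (b : Fin N → Fin 2) :
    amp u lams (c₁ ++ p :: q :: c₂) (t ∘ Equiv.swap p q) b -
        amp u lams (c₁ ++ q :: p :: c₂) (t ∘ Equiv.swap p q) b =
      amp u lams (c₁ ++ p :: q :: c₂) t b - amp u lams (c₁ ++ q :: p :: c₂) t b := by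
  have hnd' : (c₁ ++ p :: q :: c₂).Nodup :=
    (List.Perm.append_left c₁ (List.Perm.swap p q c₂)).nodup_iff.1 hnd
  -- `A' = P B` and `B' = P A`
  have hA' := amp_swap_inhom u lams c₁ c₂ p q t hnd b
  have hB' := amp_swap_inhom u lams c₁ c₂ q p t hnd' b
  rw [Equiv.swap_comm q p] at hB'
  rw [hA', hB']
  have h1 := amp_order_diff u lams c₁ c₂ p q t hnd hd (b ∘ Equiv.swap p q)
  have h2 := amp_order_diff u lams c₁ c₂ p q t hnd hd b
  have hss : (b ∘ Equiv.swap p q) ∘ Equiv.swap p q = b := by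
    funext i
    simp
  rw [hss] at h1
  linear_combination -h1 - h2

/-- The algebraic core of the Schrödinger equation at a doubly occupied site (Essler et al.
(3.B.21)–(3.B.22) ⟸ (3.B.30)–(3.B.31)): with `A, B` the amplitudes of the two orderings, `A', B'`
the same with the inhomogeneities of the pair exchanged, and weights `E_p, E_p⁻, E_q, E_q⁻` with
`(E_p - E_p⁻) - (E_q - E_q⁻) = 2i(t_p - t_q)` (on the lattice `E_p^± = e^{±ik_p}`, `t_p = sin k_p`),
`(E_p + E_q⁻)(B - A) - 4u A = (E_q + E_p⁻)(B' - A') - 4u A'` — this is where `η = 2iu` enters.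
[cite: EsslerEtAl2005, eqs. (3.B.21)–(3.B.22), (3.B.30)] -/
theorem pair_core (hd : t p - t q + eta u ≠ 0) (b : Fin N → Fin 2) (Ep Em Eq Eqm : ℂ)
    (hE : (Ep - Em) - (Eq - Eqm) = 2 * I * (t p - t q)) :
    (Ep + Eqm) * (amp u lams (c₁ ++ p :: q :: c₂) t b - amp u lams (c₁ ++ q :: p :: c₂) t b) -
        4 * u * amp u lams (c₁ ++ q :: p :: c₂) t b =
      (Eq + Em) * (amp u lams (c₁ ++ p :: q :: c₂) (t ∘ Equiv.swap p q) b -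
          amp u lams (c₁ ++ q :: p :: c₂) (t ∘ Equiv.swap p q) b) -
        4 * u * amp u lams (c₁ ++ q :: p :: c₂) (t ∘ Equiv.swap p q) b := by
  have h1 := amp_order_diff u lams c₁ c₂ p q t hnd hd b
  have h2 := amp_order_diff_swap_inhom u lams c₁ c₂ p q t hnd hd b
  -- `A' = P B` and `P B - P A = η/(d+η) (A - P A)`
  have hA' := amp_swap_inhom u lams c₁ c₂ p q t hnd b
  have h3 := amp_order_diff u lams c₁ c₂ p q t hnd hd (b ∘ Equiv.swap p q)
  have hss : (b ∘ Equiv.swap p q) ∘ Equiv.swap p q = b := by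
    funext i
    simp
  rw [hss] at h3
  rw [h2, hA']
  set A := amp u lams (c₁ ++ q :: p :: c₂) t b
  set PA := amp u lams (c₁ ++ q :: p :: c₂) t (b ∘ Equiv.swap p q)
  set B := amp u lams (c₁ ++ p :: q :: c₂) t b
  set PB := amp u lams (c₁ ++ p :: q :: c₂) t (b ∘ Equiv.swap p q)
  have hη : eta u = 2 * I * u := rfl
  rw [hη] at h1 h3 hd
  -- clear denominators in the two relations
  have e1 : (B - A) * (t p - t q + 2 * I * u) = 2 * I * u * (PA - A) := by
    rw [h1]; field_simp
  have e2 : (PB - PA) * (t p - t q + 2 * I * u) = 2 * I * u * (A - PA) := by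
    rw [h3]; field_simp
  -- the goal, multiplied by the nonzero `d + η`
  have key : ((Ep + Eqm) * (B - A) - 4 * u * A - ((Eq + Em) * (B - A) - 4 * u * PB)) *
      (t p - t q + 2 * I * u) = 0 := by
    linear_combination (Ep + Eqm - Eq - Em) * e1 + (4 * u) * e2 + (2 * I * u) * (PA - A) * hE +
      (4 * u * (t p - t q) * (PA - A)) * Complex.I_sq
  have := (mul_eq_zero.1 key).resolve_right hd
  exact sub_eq_zero.1 this

end Pair

/-! ### Independence of the ordering within ties (Essler et al. (3.B.16)–(3.B.18), (3.B.29)) -/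

section Ties

variable (u : ℂ) (k : Fin N → ℂ) (lams : List ℂ)
  (hgen : ∀ i j : Fin N, Complex.sin (k i) - Complex.sin (k j) + eta u ≠ 0)
include hgen

omit hgen in
/-- Exchanging the momenta of two electrons exchanges their inhomogeneities. [folklore] -/
theorem inhom_mul_swap (R : Equiv.Perm (Fin N)) (p q : Fin N) :
    inhom k (R * Equiv.swap p q) = inhom k R ∘ Equiv.swap p q := by
  funext i
  simp [inhom, Equiv.Perm.mul_apply]

omit hgen in
/-- The plane wave is symmetric under exchanging the momenta of two electrons at the same site.
[folklore] -/
theorem planeWave_mul_swap (R : Equiv.Perm (Fin N)) {p q : Fin N} (x : Fin N → ℤ) (hx : x p = x q) :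
    planeWave k (R * Equiv.swap p q) x = planeWave k R x := by
  unfold planeWave
  congr 2
  rw [← Equiv.sum_comp (Equiv.swap p q) (fun j => k (R j) * (x j : ℂ))]
  refine Finset.sum_congr rfl fun j _ => ?_
  simp only [Equiv.Perm.mul_apply]
  congr 2
  by_cases hjp : j = p
  · subst hjp; rw [Equiv.swap_apply_left, hx]
  · by_cases hjq : j = q
    · subst hjq; rw [Equiv.swap_apply_right, hx]
    · rw [Equiv.swap_apply_of_ne_of_ne hjp hjq]

/-- **Two electrons at the same site may be taken in either order** (uniqueness of the wave
function on the sector boundaries, Essler et al. (3.B.17)–(3.B.18) ⟸ (3.B.29)).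
[cite: EsslerEtAl2005, eqs. (3.B.17)–(3.B.18), (3.B.29)] -/
theorem psiOrd_swap_of_tie (c₁ c₂ : List (Fin N)) (p q : Fin N) (hnd : (c₁ ++ q :: p :: c₂).Nodup)
    (x : Fin N → ℤ) (hx : x p = x q) (a : Fin N → Fin 2) :
    psiOrd u k lams (c₁ ++ q :: p :: c₂) x a = psiOrd u k lams (c₁ ++ p :: q :: c₂) x a := by
  have hpq : p ≠ q := by
    intro h
    rw [h, List.nodup_append] at hnd
    exact (List.nodup_cons.1 hnd.2.1).1 (List.mem_cons_self)
  -- the difference, as a sum over `R`, is odd under `R ↦ R ∘ (p q)`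
  set F : Equiv.Perm (Fin N) → ℂ := fun R => ((Equiv.Perm.sign R : ℤ) : ℂ) * planeWave k R x *
    (amp u lams (c₁ ++ p :: q :: c₂) (inhom k R) a - amp u lams (c₁ ++ q :: p :: c₂) (inhom k R) a) with hF
  have hdiff : psiOrd u k lams (c₁ ++ p :: q :: c₂) x a - psiOrd u k lams (c₁ ++ q :: p :: c₂) x a =
      ∑ R, F R := by
    simp only [psiOrd, ← Finset.sum_sub_distrib, hF, mul_sub]
  have hodd : ∀ R, F (R * Equiv.swap p q) = -F R := by
    intro R
    simp only [hF, Equiv.Perm.sign_mul, Equiv.Perm.sign_swap hpq, Units.val_mul, Units.val_neg,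
      Units.val_one, Int.cast_mul, Int.cast_neg, Int.cast_one, planeWave_mul_swap k R x hx,
      inhom_mul_swap,
      amp_order_diff_swap_inhom u lams c₁ c₂ p q (inhom k R) hnd (hgen (R p) (R q)) a]
    ring
  have hsum : ∑ R, F R = -∑ R, F R := by
    conv_lhs => rw [← Equiv.sum_comp (Equiv.mulRight (Equiv.swap p q)) F]
    simp only [Equiv.coe_mulRight, hodd, Finset.sum_neg_distrib]
  have hzero : ∑ R, F R = 0 := by
    have h2 : (2 : ℂ) * ∑ R, F R = 0 := by linear_combination hsum
    exact (mul_eq_zero.1 h2).resolve_left two_ne_zero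
  rw [hzero] at hdiff
  exact (sub_eq_zero.1 hdiff).symm

/-- Moving an electron to the left through a block of electrons at the same site.
[cite: EsslerEtAl2005, eqs. (3.B.16)–(3.B.18)] -/
theorem psiOrd_move_left (h : Fin N) (A : List (Fin N)) (x : Fin N → ℤ) (hA : ∀ a ∈ A, x a = x h)
    (a : Fin N → Fin 2) :
    ∀ (P T : List (Fin N)), (P ++ A ++ h :: T).Nodup →
      psiOrd u k lams (P ++ A ++ h :: T) x a = psiOrd u k lams (P ++ h :: (A ++ T)) x a := by
  induction A with
  | nil => intro P T _; simp
  | cons b A ih =>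
      intro P T hnd
      have hassoc : P ++ b :: A ++ h :: T = (P ++ [b]) ++ A ++ h :: T := by simp
      rw [hassoc, ih (fun a ha => hA a (List.mem_cons_of_mem _ ha)) (P ++ [b]) T (by rwa [← hassoc])]
      have hassoc2 : P ++ [b] ++ h :: (A ++ T) = P ++ b :: h :: (A ++ T) := by simp
      rw [hassoc2]
      have hnd' : (P ++ b :: h :: (A ++ T)).Nodup := by
        have hperm : (P ++ b :: A ++ h :: T).Perm (P ++ b :: h :: (A ++ T)) := by
          have h1 : (A ++ h :: T).Perm (h :: (A ++ T)) := List.perm_middle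
          have h2 := List.Perm.append_left P (List.Perm.cons b h1)
          simpa [List.append_assoc] using h2
        exact hperm.nodup_iff.1 hnd
      rw [psiOrd_swap_of_tie u k lams hgen P (A ++ T) h b hnd' x (hA b List.mem_cons_self).symm a]
      simp

/-- **Independence of the ordering within ties.** Two orderings of the same electrons that are
both non-increasing in position give the same wave function (on the closed sector
`x_{c(1)} ≥ x_{c(2)} ≥ ⋯`, Essler et al. (3.B.16)–(3.B.19)).
[cite: EsslerEtAl2005, eqs. (3.B.16)–(3.B.19)] -/
theorem psiOrd_eq_of_sorted (x : Fin N → ℤ) (a : Fin N → Fin 2) :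
    ∀ (c c' : List (Fin N)), c.Perm c' → c.Pairwise (fun i j => x j ≤ x i) →
      c'.Pairwise (fun i j => x j ≤ x i) → ∀ (P S : List (Fin N)), (P ++ c ++ S).Nodup →
        psiOrd u k lams (P ++ c ++ S) x a = psiOrd u k lams (P ++ c' ++ S) x a := by
  intro c
  induction c with
  | nil =>
      intro c' hperm _ _ P S _
      rw [List.nil_perm] at hperm
      rw [hperm]
  | cons h r ih =>
      intro c' hperm hs hs' P S hnd
      have hh : h ∈ c' := hperm.subset List.mem_cons_self
      obtain ⟨A, B, rfl⟩ := List.append_of_mem hh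
      have hnd_hr : (h :: r).Nodup := (List.nodup_append.1 (List.nodup_append.1 hnd).1).2.1
      have hnd_c' : (A ++ h :: B).Nodup := hperm.nodup_iff.1 hnd_hr
      have hhA : h ∉ A := by
        intro hA
        rw [List.nodup_append] at hnd_c'
        exact hnd_c'.2.2 h hA h List.mem_cons_self rfl
      -- every electron of `A` sits at the position of `h`
      have hA : ∀ b ∈ A, x b = x h := by
        intro b hb
        have h1 : x h ≤ x b := (List.pairwise_append.1 hs').2.2 b hb h List.mem_cons_self
        have hbc' : b ∈ A ++ h :: B := List.mem_append_left _ hb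
        have hbhr : b ∈ h :: r := hperm.symm.subset hbc'
        have hbh : b ≠ h := fun e => hhA (e ▸ hb)
        have hbr : b ∈ r := (List.mem_cons.1 hbhr).resolve_left hbh
        have h2 : x b ≤ x h := (List.pairwise_cons.1 hs).1 b hbr
        exact le_antisymm h2 h1
      -- move `h` to the front of `c'`
      have hperm_big : (P ++ (h :: r) ++ S).Perm (P ++ A ++ h :: (B ++ S)) := by
        have : (P ++ (h :: r) ++ S).Perm (P ++ (A ++ h :: B) ++ S) :=
          (hperm.append_left P).append_right S
        simpa [List.append_assoc] using this
      have step1 : psiOrd u k lams (P ++ (A ++ h :: B) ++ S) x a =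
          psiOrd u k lams (P ++ h :: (A ++ (B ++ S))) x a := by
        have := psiOrd_move_left u k lams hgen h A x hA a P (B ++ S) (hperm_big.nodup_iff.1 hnd)
        simpa [List.append_assoc] using this
      -- induction hypothesis for `r ~ A ++ B`
      have hperm' : r.Perm (A ++ B) := by
        have : (h :: r).Perm (h :: (A ++ B)) := hperm.trans List.perm_middle
        exact List.Perm.cons_inv this
      have hsr : r.Pairwise (fun i j => x j ≤ x i) := (List.pairwise_cons.1 hs).2
      have hsAB : (A ++ B).Pairwise (fun i j => x j ≤ x i) :=
        hs'.sublist ((List.Sublist.refl A).append (List.sublist_cons_self h B))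
      have hnd' : ((P ++ [h]) ++ r ++ S).Nodup := by simpa using hnd
      have step2 := ih (A ++ B) hperm' hsr hsAB (P ++ [h]) S hnd'
      calc psiOrd u k lams (P ++ h :: r ++ S) x a = psiOrd u k lams ((P ++ [h]) ++ r ++ S) x a := by simp
        _ = psiOrd u k lams ((P ++ [h]) ++ (A ++ B) ++ S) x a := step2
        _ = psiOrd u k lams (P ++ h :: (A ++ (B ++ S))) x a := by simp
        _ = psiOrd u k lams (P ++ (A ++ h :: B) ++ S) x a := step1.symm

/-! ### The canonical ordering; `ψ` is any sorted `ψ_c` -/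

omit hgen in
/-- The canonical ordering lists each electron once. [folklore] -/
theorem canon_nodup (x : Fin N → ℤ) : (canon x).Nodup :=
  List.nodup_reverse.2 (List.nodup_ofFn.2 (Tuple.sort x).injective)

omit hgen in
/-- The canonical ordering lists every electron. [folklore] -/
theorem mem_canon (x : Fin N → ℤ) (i : Fin N) : i ∈ canon x := by
  rw [canon, List.mem_reverse, List.mem_ofFn]
  exact ⟨(Tuple.sort x).symm i, Equiv.apply_symm_apply _ _⟩

omit hgen in
/-- The canonical ordering is non-increasing in position. [folklore] -/
theorem canon_sorted (x : Fin N → ℤ) : (canon x).Pairwise (fun i j => x j ≤ x i) := by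
  rw [canon, List.pairwise_reverse, List.pairwise_ofFn]
  intro i j hij
  exact Tuple.monotone_sort x hij.le

/-- **`ψ` may be computed with any ordering of the electrons that is non-increasing in
position.** [cite: EsslerEtAl2005, eq. (3.B.19)] -/
theorem psi_eq_psiOrd (x : Fin N → ℤ) (c : List (Fin N)) (hc : c.Nodup) (hall : ∀ i, i ∈ c)
    (hs : c.Pairwise (fun i j => x j ≤ x i)) (a : Fin N → Fin 2) :
    psi u k lams x a = psiOrd u k lams c x a := by
  have hperm : (canon x).Perm c :=
    (List.perm_ext_iff_of_nodup (canon_nodup x) hc).2 fun i => ⟨fun _ => hall i, fun _ => mem_canon x i⟩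
  have := psiOrd_eq_of_sorted u k lams hgen x a (canon x) c hperm (canon_sorted x) hs [] []
    (by simpa using canon_nodup x)
  simpa [psi] using this

end Ties

/-! ### The free Schrödinger equation inside the sectors (Essler et al. (3.B.4)–(3.B.6)) -/

section Free

variable (u : ℂ) (k : Fin N → ℂ) (lams : List ℂ)

/-- Moving one electron multiplies the plane wave by a phase. [folklore] -/
theorem planeWave_update (R : Equiv.Perm (Fin N)) (x : Fin N → ℤ) (j : Fin N) (v : ℤ) :
    planeWave k R (Function.update x j v) =
      Complex.exp (I * (k (R j) * ((v : ℂ) - x j))) * planeWave k R x := by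
  unfold planeWave
  rw [← Complex.exp_add]
  congr 1
  have h1 : (fun i => k (R i) * ((Function.update x j v i : ℤ) : ℂ)) =
      Function.update (fun i => k (R i) * (x i : ℂ)) j (k (R j) * (v : ℂ)) := by
    funext i
    by_cases hi : i = j
    · subst hi; simp
    · simp [Function.update_of_ne hi]
  rw [h1, Finset.sum_update_of_mem (Finset.mem_univ j), ← Finset.add_sum_erase _ _ (Finset.mem_univ j),
    Finset.sdiff_singleton_eq_erase]
  ring

/-- **The free difference equation.** For every ordering `c`, `ψ_c` (extended by its plane waves
to all of `ℤ^N`) satisfies `-Σ_j (Δ_j⁺ + Δ_j⁻) ψ_c = E ψ_c` with `E = -2 Σ_j cos k_j`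
(Essler et al. (3.B.4)–(3.B.6)). [cite: EsslerEtAl2005, eqs. (3.B.4)–(3.B.6)] -/
theorem psiOrd_free (c : List (Fin N)) (x : Fin N → ℤ) (a : Fin N → Fin 2) :
    ∑ j, (psiOrd u k lams c (Function.update x j (x j + 1)) a +
        psiOrd u k lams c (Function.update x j (x j - 1)) a) =
      (2 * ∑ j, Complex.cos (k j)) * psiOrd u k lams c x a := by
  have hphase : ∀ (R : Equiv.Perm (Fin N)) (j : Fin N),
      planeWave k R (Function.update x j (x j + 1)) + planeWave k R (Function.update x j (x j - 1)) =
        2 * Complex.cos (k (R j)) * planeWave k R x := by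
    intro R j
    rw [planeWave_update, planeWave_update, ← add_mul, Complex.two_cos]
    push_cast
    congr 1
    rw [show I * (k (R j) * ((x j : ℂ) + 1 - x j)) = k (R j) * I by ring,
      show I * (k (R j) * ((x j : ℂ) - 1 - x j)) = -k (R j) * I by ring]
  have hcos : ∀ R : Equiv.Perm (Fin N), ∑ j, 2 * Complex.cos (k (R j)) = 2 * ∑ j, Complex.cos (k j) := by
    intro R
    rw [Finset.mul_sum]
    exact Equiv.sum_comp R (fun j => 2 * Complex.cos (k j))
  calc ∑ j, (psiOrd u k lams c (Function.update x j (x j + 1)) a +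
        psiOrd u k lams c (Function.update x j (x j - 1)) a)
      = ∑ R : Equiv.Perm (Fin N), ((Equiv.Perm.sign R : ℤ) : ℂ) * (2 * ∑ j, Complex.cos (k j)) *
          planeWave k R x * amp u lams c (inhom k R) a := by
        simp only [psiOrd, ← Finset.sum_add_distrib]
        rw [Finset.sum_comm]
        refine Finset.sum_congr rfl fun R _ => ?_
        rw [← hcos R, Finset.mul_sum, Finset.sum_mul, Finset.sum_mul]
        refine Finset.sum_congr rfl fun j _ => ?_
        rw [show ((Equiv.Perm.sign R : ℤ) : ℂ) * planeWave k R (Function.update x j (x j + 1)) *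
              amp u lams c (inhom k R) a +
            ((Equiv.Perm.sign R : ℤ) : ℂ) * planeWave k R (Function.update x j (x j - 1)) *
              amp u lams c (inhom k R) a =
            ((Equiv.Perm.sign R : ℤ) : ℂ) * (planeWave k R (Function.update x j (x j + 1)) +
              planeWave k R (Function.update x j (x j - 1))) * amp u lams c (inhom k R) a by ring,
          hphase R j]
        ring
    _ = (2 * ∑ j, Complex.cos (k j)) * psiOrd u k lams c x a := by
        unfold psiOrd
        rw [Finset.mul_sum (s := (Finset.univ : Finset (Equiv.Perm (Fin N))))]
        refine Finset.sum_congr rfl fun R _ => ?_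
        ring

end Free

/-! ### The Schrödinger equation at a doubly occupied site (Essler et al. (3.B.21)–(3.B.22)) -/

section Interaction

variable (u : ℂ) (k : Fin N → ℂ) (lams : List ℂ)
  (hgen : ∀ i j : Fin N, Complex.sin (k i) - Complex.sin (k j) + eta u ≠ 0)
include hgen

/-- **The pair identity.** For two electrons `q, p` at the same site, adjacent in the ordering
`c = c₁ q p c₂`, with `c' = c₁ p q c₂`:
`[ψ_{c'} - ψ_c](x + e_p) + [ψ_{c'} - ψ_c](x - e_q) = 4u ψ_c(x)` — the two moves that violate the
ordering `c` are compensated by the on-site interaction (Essler et al. (3.B.21)–(3.B.22)).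
[cite: EsslerEtAl2005, eqs. (3.B.21)–(3.B.22)] -/
theorem psiOrd_pair (c₁ c₂ : List (Fin N)) (p q : Fin N) (hnd : (c₁ ++ q :: p :: c₂).Nodup)
    (x : Fin N → ℤ) (hx : x p = x q) (a : Fin N → Fin 2) :
    psiOrd u k lams (c₁ ++ p :: q :: c₂) (Function.update x p (x p + 1)) a -
          psiOrd u k lams (c₁ ++ q :: p :: c₂) (Function.update x p (x p + 1)) a +
        (psiOrd u k lams (c₁ ++ p :: q :: c₂) (Function.update x q (x q - 1)) a -
          psiOrd u k lams (c₁ ++ q :: p :: c₂) (Function.update x q (x q - 1)) a) =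
      4 * u * psiOrd u k lams (c₁ ++ q :: p :: c₂) x a := by
  have hpq : p ≠ q := by
    intro h
    rw [h, List.nodup_append] at hnd
    exact (List.nodup_cons.1 hnd.2.1).1 (List.mem_cons_self)
  -- everything as one sum over `R`
  set G : Equiv.Perm (Fin N) → ℂ := fun R => ((Equiv.Perm.sign R : ℤ) : ℂ) * planeWave k R x *
    ((Complex.exp (I * k (R p)) + Complex.exp (-(I * k (R q)))) *
      (amp u lams (c₁ ++ p :: q :: c₂) (inhom k R) a - amp u lams (c₁ ++ q :: p :: c₂) (inhom k R) a) -
      4 * u * amp u lams (c₁ ++ q :: p :: c₂) (inhom k R) a) with hG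
  have hLHS : psiOrd u k lams (c₁ ++ p :: q :: c₂) (Function.update x p (x p + 1)) a -
          psiOrd u k lams (c₁ ++ q :: p :: c₂) (Function.update x p (x p + 1)) a +
        (psiOrd u k lams (c₁ ++ p :: q :: c₂) (Function.update x q (x q - 1)) a -
          psiOrd u k lams (c₁ ++ q :: p :: c₂) (Function.update x q (x q - 1)) a) -
      4 * u * psiOrd u k lams (c₁ ++ q :: p :: c₂) x a = ∑ R, G R := by
    simp only [psiOrd, ← Finset.sum_sub_distrib, ← Finset.sum_add_distrib, Finset.mul_sum, hG,
      planeWave_update]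
    refine Finset.sum_congr rfl fun R _ => ?_
    push_cast
    rw [show I * (k (R p) * ((x p : ℂ) + 1 - x p)) = I * k (R p) by ring,
      show I * (k (R q) * ((x q : ℂ) - 1 - x q)) = -(I * k (R q)) by ring]
    ring
  -- the summand is odd under `R ↦ R (p q)` by `pair_core`
  have hodd : ∀ R, G (R * Equiv.swap p q) = -G R := by
    intro R
    have hcore := pair_core u lams c₁ c₂ p q (inhom k R) hnd (hgen (R p) (R q)) a
      (Complex.exp (I * k (R p))) (Complex.exp (-(I * k (R p)))) (Complex.exp (I * k (R q)))
      (Complex.exp (-(I * k (R q)))) (by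
        simp only [inhom]
        rw [show (2 : ℂ) * I * (Complex.sin (k (R p)) - Complex.sin (k (R q))) =
          I * (2 * Complex.sin (k (R p))) - I * (2 * Complex.sin (k (R q))) by ring,
          Complex.two_sin, Complex.two_sin]
        ring_nf
        rw [Complex.I_sq]
        ring)
    simp only [hG, Equiv.Perm.sign_mul, Equiv.Perm.sign_swap hpq, Units.val_mul, Units.val_neg,
      Units.val_one, Int.cast_mul, Int.cast_neg, Int.cast_one, planeWave_mul_swap k R x hx,
      inhom_mul_swap, Equiv.Perm.mul_apply, Equiv.swap_apply_left, Equiv.swap_apply_right]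
    rw [hcore]
    ring
  have hsum : ∑ R, G R = -∑ R, G R := by
    conv_lhs => rw [← Equiv.sum_comp (Equiv.mulRight (Equiv.swap p q)) G]
    simp only [Equiv.coe_mulRight, hodd, Finset.sum_neg_distrib]
  have hzero : ∑ R, G R = 0 := by
    have h2 : (2 : ℂ) * ∑ R, G R = 0 := by linear_combination hsum
    exact (mul_eq_zero.1 h2).resolve_left two_ne_zero
  rw [hzero] at hLHS
  exact sub_eq_zero.1 hLHS

/-! ### Bookkeeping of the moves: sortedness after a move, tied pairs -/

omit hgen in
/-- Sortedness of an ordering after one electron has moved, given where it lands relative to its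
neighbours in the ordering. [folklore] -/
theorem pairwise_update (x : Fin N → ℤ) (L₁ L₂ : List (Fin N)) (i : Fin N) (hi₁ : i ∉ L₁) (hi₂ : i ∉ L₂)
    (hs : (L₁ ++ i :: L₂).Pairwise (fun m m' => x m' ≤ x m)) (v : ℤ)
    (h₁ : ∀ m ∈ L₁, v ≤ x m) (h₂ : ∀ m ∈ L₂, x m ≤ v) :
    (L₁ ++ i :: L₂).Pairwise (fun m m' => Function.update x i v m' ≤ Function.update x i v m) := by
  rw [List.pairwise_append, List.pairwise_cons] at hs ⊢
  obtain ⟨hs1, ⟨hsi, hs2⟩, hs12⟩ := hs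
  refine ⟨?_, ⟨?_, ?_⟩, ?_⟩
  · exact hs1.imp_of_mem fun {a b} ha hb hab => by
      rwa [Function.update_of_ne (ne_of_mem_of_not_mem ha hi₁),
        Function.update_of_ne (ne_of_mem_of_not_mem hb hi₁)]
  · intro b hb
    rw [Function.update_self, Function.update_of_ne (ne_of_mem_of_not_mem hb hi₂)]
    exact h₂ b hb
  · exact hs2.imp_of_mem fun {a b} ha hb hab => by
      rwa [Function.update_of_ne (ne_of_mem_of_not_mem ha hi₂),
        Function.update_of_ne (ne_of_mem_of_not_mem hb hi₂)]
  · intro a ha b hb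
    rw [Function.update_of_ne (ne_of_mem_of_not_mem ha hi₁)]
    rcases List.mem_cons.1 hb with rfl | hb
    · rw [Function.update_self]
      exact h₁ a ha
    · rw [Function.update_of_ne (ne_of_mem_of_not_mem hb hi₂)]
      exact hs12 a ha b (List.mem_cons_of_mem _ hb)

omit hgen in
/-- Exchanging two tied adjacent electrons keeps an ordering sorted. [folklore] -/
theorem pairwise_swap_tied (x : Fin N → ℤ) (P r : List (Fin N)) (i j : Fin N) (hij : x i = x j)
    (hs : (P ++ i :: j :: r).Pairwise (fun m m' => x m' ≤ x m)) :
    (P ++ j :: i :: r).Pairwise (fun m m' => x m' ≤ x m) := by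
  rw [List.pairwise_append] at hs ⊢
  obtain ⟨hs1, hs2, hs12⟩ := hs
  refine ⟨hs1, ?_, ?_⟩
  · rw [List.pairwise_cons, List.pairwise_cons] at hs2 ⊢
    obtain ⟨hi, hj, hr⟩ := hs2
    refine ⟨?_, ?_, hr⟩
    · intro b hb
      rcases List.mem_cons.1 hb with rfl | hb
      · exact hij.le
      · rw [← hij]; exact hi b (List.mem_cons_of_mem _ hb)
    · intro b hb
      rw [hij]; exact hj b hb
  · intro a ha b hb
    refine hs12 a ha b ?_
    rcases List.mem_cons.1 hb with rfl | hb
    · exact List.mem_cons_of_mem _ List.mem_cons_self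
    · rcases List.mem_cons.1 hb with rfl | hb
      · exact List.mem_cons_self
      · exact List.mem_cons_of_mem _ (List.mem_cons_of_mem _ hb)

/-- The number of tied adjacent pairs (doubly occupied sites) along an ordering. [folklore] -/
def tiedCount (x : Fin N → ℤ) : List (Fin N) → ℕ
  | [] => 0
  | [_] => 0
  | i :: j :: r => (if x i = x j then 1 else 0) + tiedCount x (j :: r)

omit hgen in
/-- No pairs in the empty ordering. [folklore] -/
@[simp] theorem tiedCount_nil (x : Fin N → ℤ) : tiedCount x [] = 0 := rfl

omit hgen in
/-- No pairs in a one-electron ordering. [folklore] -/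
@[simp] theorem tiedCount_single (x : Fin N → ℤ) (i : Fin N) : tiedCount x [i] = 0 := rfl

omit hgen in
/-- Unfolding the pair count. [folklore] -/
theorem tiedCount_cons_cons (x : Fin N → ℤ) (i j : Fin N) (r : List (Fin N)) :
    tiedCount x (i :: j :: r) = (if x i = x j then 1 else 0) + tiedCount x (j :: r) := rfl

omit hgen in
/-- An electron not tied with the next one does not contribute a pair. [folklore] -/
theorem tiedCount_cons_of_ne (x : Fin N → ℤ) (j : Fin N) (r : List (Fin N))
    (h : ∀ m ∈ r.head?, x j ≠ x m) : tiedCount x (j :: r) = tiedCount x r := by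
  cases r with
  | nil => rfl
  | cons m r' =>
      rw [tiedCount_cons_cons, if_neg (h m rfl), zero_add]

/-- **Block decomposition of the Schrödinger equation.** For a sorted ordering `L = P ++ c` of an
`x` without triply occupied sites, the sum over the electrons of `c` of `ψ(x + e_j) + ψ(x - e_j)`
equals the same sum for the plane-wave continuation `ψ_L` plus `4u ψ_L(x)` per tied pair of `c`
(each doubly occupied site contributes exactly the two order-violating moves of the pair
identity). [cite: EsslerEtAl2005, eqs. (3.B.20)–(3.B.22)] -/
theorem block_sum (x : Fin N → ℤ) (a : Fin N → Fin 2) (L : List (Fin N)) (hL : L.Nodup)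
    (hall : ∀ i, i ∈ L) (hs : L.Pairwise (fun i j => x j ≤ x i))
    (h3 : ∀ i j m : Fin N, i ≠ j → j ≠ m → i ≠ m → x i = x j → x j = x m → False) :
    ∀ (n : ℕ) (c P : List (Fin N)), c.length = n → L = P ++ c →
      (∀ m ∈ P, ∀ h ∈ c.head?, x h < x m) →
      (c.map fun j => psi u k lams (Function.update x j (x j + 1)) a +
          psi u k lams (Function.update x j (x j - 1)) a).sum =
        (c.map fun j => psiOrd u k lams L (Function.update x j (x j + 1)) a +
            psiOrd u k lams L (Function.update x j (x j - 1)) a).sum +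
          4 * u * (tiedCount x c) * psiOrd u k lams L x a := by
  intro n
  induction n using Nat.strong_induction_on with
  | _ n ih =>
  intro c P hlen hL_eq hbd
  match c with
  | [] => simp
  | [i] =>
      subst hL_eq
      have hiP : i ∉ P := by
        intro h
        rw [List.nodup_append] at hL
        exact hL.2.2 i h i List.mem_cons_self rfl
      have hplus : psi u k lams (Function.update x i (x i + 1)) a =
          psiOrd u k lams (P ++ [i]) (Function.update x i (x i + 1)) a :=
        psi_eq_psiOrd u k lams hgen _ _ hL hall
          (pairwise_update x P [] i hiP List.not_mem_nil hs (x i + 1)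
            (fun m hm => by have := hbd m hm i rfl; omega) (fun m hm => absurd hm List.not_mem_nil)) a
      have hminus : psi u k lams (Function.update x i (x i - 1)) a =
          psiOrd u k lams (P ++ [i]) (Function.update x i (x i - 1)) a :=
        psi_eq_psiOrd u k lams hgen _ _ hL hall
          (pairwise_update x P [] i hiP List.not_mem_nil hs (x i - 1)
            (fun m hm => by have := hbd m hm i rfl; omega) (fun m hm => absurd hm List.not_mem_nil)) a
      simp [hplus, hminus]
  | i :: j :: r =>
      have hlen' : r.length < n := by rw [← hlen]; simp
      have hlen'' : (j :: r).length < n := by rw [← hlen]; simp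
      subst hL_eq
      -- distinctness facts
      have hnd := hL
      rw [List.nodup_append] at hnd
      obtain ⟨hndP, hndc, hdis⟩ := hnd
      have hiP : i ∉ P := fun h => hdis i h i List.mem_cons_self rfl
      have hjP : j ∉ P := fun h => hdis j h j (List.mem_cons_of_mem _ List.mem_cons_self) rfl
      rw [List.nodup_cons, List.mem_cons, not_or, List.nodup_cons] at hndc
      obtain ⟨⟨hij, hir⟩, hjr, hndr⟩ := hndc
      -- sortedness facts
      have hs' := hs
      rw [List.pairwise_append, List.pairwise_cons, List.pairwise_cons] at hs'
      obtain ⟨-, ⟨hi_le, hj_le, -⟩, hP_le⟩ := hs'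
      have hxji : x j ≤ x i := hi_le j List.mem_cons_self
      by_cases htie : x i = x j
      · -- a doubly occupied site: the pair block `i j`
        have hr_lt : ∀ m ∈ r, x m < x j := by
          intro m hm
          have hle : x m ≤ x j := hj_le m hm
          rcases hle.lt_or_eq with hlt | heq
          · exact hlt
          · exact (h3 i j m hij (fun h => hjr (h ▸ hm)) (fun h => hir (h ▸ hm)) htie heq.symm).elim
        -- the four moves of the pair
        have hL' : (P ++ j :: i :: r).Nodup :=
          (List.Perm.append_left P (List.Perm.swap i j r)).nodup_iff.2 hL
        have hall' : ∀ m, m ∈ P ++ j :: i :: r := fun m =>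
          (List.Perm.append_left P (List.Perm.swap i j r)).symm.subset (hall m)
        have hsL' : (P ++ j :: i :: r).Pairwise (fun m m' => x m' ≤ x m) := pairwise_swap_tied x P r i j htie hs
        have hijr : i ∉ j :: r := fun h => by
          rcases List.mem_cons.1 h with h | h
          · exact hij h
          · exact hir h
        have hjir : j ∉ i :: r := fun h => by
          rcases List.mem_cons.1 h with h | h
          · exact hij h.symm
          · exact hjr h
        have hiPj : i ∉ P ++ [j] := fun h => by
          rcases List.mem_append.1 h with h | h
          · exact hiP h
          · exact hij (List.mem_singleton.1 h)
        have hjPi : j ∉ P ++ [i] := fun h => by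
          rcases List.mem_append.1 h with h | h
          · exact hjP h
          · exact hij (List.mem_singleton.1 h).symm
        have e1 : psi u k lams (Function.update x i (x i + 1)) a =
            psiOrd u k lams (P ++ i :: j :: r) (Function.update x i (x i + 1)) a :=
          psi_eq_psiOrd u k lams hgen _ _ hL hall
            (pairwise_update x P (j :: r) i hiP hijr hs (x i + 1)
              (fun m hm => by have := hbd m hm i rfl; omega)
              (fun m hm => by have := hi_le m hm; omega)) a
        have e2 : psi u k lams (Function.update x j (x j - 1)) a =
            psiOrd u k lams (P ++ i :: j :: r) (Function.update x j (x j - 1)) a := by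
          have hform : P ++ i :: j :: r = (P ++ [i]) ++ j :: r := by simp
          rw [hform] at hL hall hs ⊢
          exact psi_eq_psiOrd u k lams hgen _ _ hL hall
            (pairwise_update x (P ++ [i]) r j hjPi hjr hs (x j - 1)
              (fun m hm => by
                rcases List.mem_append.1 hm with hm | hm
                · have := hP_le m hm j (List.mem_cons_of_mem _ List.mem_cons_self); omega
                · rw [List.mem_singleton.1 hm]; omega)
              (fun m hm => by have := hr_lt m hm; omega)) a
        have e3 : psi u k lams (Function.update x j (x j + 1)) a =
            psiOrd u k lams (P ++ j :: i :: r) (Function.update x j (x j + 1)) a :=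
          psi_eq_psiOrd u k lams hgen _ _ hL' hall'
            (pairwise_update x P (i :: r) j hjP hjir hsL' (x j + 1)
              (fun m hm => by have := hbd m hm i rfl; omega)
              (fun m hm => by
                rcases List.mem_cons.1 hm with rfl | hm
                · omega
                · have := hr_lt m hm; omega)) a
        have e4 : psi u k lams (Function.update x i (x i - 1)) a =
            psiOrd u k lams (P ++ j :: i :: r) (Function.update x i (x i - 1)) a := by
          have hform : P ++ j :: i :: r = (P ++ [j]) ++ i :: r := by simp
          have hL'' := hL'
          have hall'' := hall'
          have hsL'' := hsL'
          rw [hform] at hL'' hall'' hsL'' ⊢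
          exact psi_eq_psiOrd u k lams hgen _ _ hL'' hall''
            (pairwise_update x (P ++ [j]) r i hiPj hir hsL'' (x i - 1)
              (fun m hm => by
                rcases List.mem_append.1 hm with hm | hm
                · have := hbd m hm i rfl; omega
                · rw [List.mem_singleton.1 hm]; omega)
              (fun m hm => by have := hr_lt m hm; omega)) a
        -- the pair identity and the induction hypothesis for the rest
        have hpair := psiOrd_pair u k lams hgen P r j i hL x (by rw [htie]) a
        have hbd' : ∀ m ∈ P ++ [i, j], ∀ h ∈ r.head?, x h < x m := by
          intro m hm h hh
          have hhr : h ∈ r := List.mem_of_mem_head? hh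
          have h1 := hr_lt h hhr
          rcases List.mem_append.1 hm with hm | hm
          · have := hbd m hm i rfl; omega
          · rcases List.mem_cons.1 hm with rfl | hm
            · omega
            · rw [List.mem_singleton.1 hm]; omega
        have hih := ih r.length hlen' r (P ++ [i, j]) rfl (by simp) hbd'
        have hT : tiedCount x (i :: j :: r) = 1 + tiedCount x r := by
          rw [tiedCount_cons_cons, if_pos htie, tiedCount_cons_of_ne]
          intro m hm
          exact (hr_lt m (List.mem_of_mem_head? hm)).ne'
        simp only [List.map_cons, List.sum_cons, hT, Nat.cast_add, Nat.cast_one]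
        rw [e1, e2, e3, e4, hih]
        linear_combination hpair
      · -- a singly occupied site: the block `i`
        have hlt : x j < x i := lt_of_le_of_ne hxji (Ne.symm htie)
        have hijr : i ∉ j :: r := fun h => by
          rcases List.mem_cons.1 h with h | h
          · exact hij h
          · exact hir h
        have e1 : psi u k lams (Function.update x i (x i + 1)) a =
            psiOrd u k lams (P ++ i :: j :: r) (Function.update x i (x i + 1)) a :=
          psi_eq_psiOrd u k lams hgen _ _ hL hall
            (pairwise_update x P (j :: r) i hiP hijr hs (x i + 1)
              (fun m hm => by have := hbd m hm i rfl; omega)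
              (fun m hm => by have := hi_le m hm; omega)) a
        have e2 : psi u k lams (Function.update x i (x i - 1)) a =
            psiOrd u k lams (P ++ i :: j :: r) (Function.update x i (x i - 1)) a :=
          psi_eq_psiOrd u k lams hgen _ _ hL hall
            (pairwise_update x P (j :: r) i hiP hijr hs (x i - 1)
              (fun m hm => by have := hbd m hm i rfl; omega)
              (fun m hm => by
                rcases List.mem_cons.1 hm with rfl | hm
                · omega
                · have := hj_le m hm; omega)) a
        have hbd' : ∀ m ∈ P ++ [i], ∀ h ∈ (j :: r).head?, x h < x m := by
          intro m hm h hh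
          have : h = j := by simpa using hh.symm
          subst this
          rcases List.mem_append.1 hm with hm | hm
          · have := hbd m hm i rfl; omega
          · rw [List.mem_singleton.1 hm]; exact hlt
        have hih := ih (j :: r).length hlen'' (j :: r) (P ++ [i]) rfl (by simp) hbd'
        have hT : tiedCount x (i :: j :: r) = tiedCount x (j :: r) := by
          rw [tiedCount_cons_cons, if_neg htie, zero_add]
        rw [List.map_cons, List.sum_cons]
        conv_rhs => rw [List.map_cons, List.sum_cons]
        rw [hT, e1, e2, hih]
        ring

omit hgen in
/-- Electrons with pairwise distinct (position, spin) labels occupy each site at most twice.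
[folklore] -/
theorem no_triple_of_orbitals (x : Fin N → ℤ) (a : Fin N → Fin 2)
    (horb : ∀ i j : Fin N, i ≠ j → x i = x j → a i ≠ a j) :
    ∀ i j m : Fin N, i ≠ j → j ≠ m → i ≠ m → x i = x j → x j = x m → False := by
  intro i j m hij hjm him h1 h2
  have a1 := Fin.val_ne_iff.2 (horb i j hij h1)
  have a2 := Fin.val_ne_iff.2 (horb j m hjm h2)
  have a3 := Fin.val_ne_iff.2 (horb i m him (h1.trans h2))
  have b1 := (a i).isLt
  have b2 := (a j).isLt
  have b3 := (a m).isLt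
  omega

omit hgen in
/-- Sums over all electrons as sums along the canonical ordering. [folklore] -/
theorem sum_eq_canon_sum (x : Fin N → ℤ) (F : Fin N → ℂ) : ∑ j, F j = ((canon x).map F).sum := by
  rw [← List.sum_toFinset F (canon_nodup x)]
  congr 1
  ext j
  simp [mem_canon x j]

/-- **The Schrödinger equation of the Hubbard chain on the infinite lattice** (Essler et al.
(3.16) with (3.15)): for every configuration `(x, a)` of `N` electrons with pairwise distinct
(position, spin) labels, the nested Bethe-ansatz wave function satisfies
`-Σ_j (ψ(x + e_j; a) + ψ(x - e_j; a)) + 4u · D(x) · ψ(x; a) = -2 (Σ_j cos k_j) ψ(x; a)`,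
`D(x)` the number of doubly occupied sites (`tiedCount`), for ANY spin rapidities `λ⃗` — the
difference equation needs no Bethe equations, only the genericity `sin k_i - sin k_j + 2iu ≠ 0`
(Essler et al. App. 3.B.2–3.B.3, eqs. (3.B.20)–(3.B.22), (3.B.29)–(3.B.31)).
[cite: EsslerEtAl2005, eqs. (3.15)–(3.16), (3.B.20)–(3.B.22)] -/
theorem schrodinger (x : Fin N → ℤ) (a : Fin N → Fin 2)
    (horb : ∀ i j : Fin N, i ≠ j → x i = x j → a i ≠ a j) :
    -(∑ j, (psi u k lams (Function.update x j (x j + 1)) a +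
        psi u k lams (Function.update x j (x j - 1)) a)) +
        4 * u * (tiedCount x (canon x)) * psi u k lams x a =
      (-2 * ∑ j, Complex.cos (k j)) * psi u k lams x a := by
  have hb := block_sum u k lams hgen x a (canon x) (canon_nodup x) (mem_canon x) (canon_sorted x)
    (no_triple_of_orbitals x a horb) (canon x).length (canon x) [] rfl (by simp)
    (fun m hm => absurd hm List.not_mem_nil)
  rw [← sum_eq_canon_sum x, ← sum_eq_canon_sum x, psiOrd_free] at hb
  rw [hb, psi]
  ring

end Interaction

/-! ### The periodic boundary condition (Essler et al. (3.B.37)–(3.B.47), (3.B.85)–(3.B.87)) -/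

section Periodic

variable (u : ℂ) (hu : u ≠ 0) (k : Fin N → ℂ) (lams : List ℂ) (hlams : lams.Nodup)
  (hgen : ∀ i j : Fin N, Complex.sin (k i) - Complex.sin (k j) + eta u ≠ 0)
  (hreg : ∀ j : Fin N, Complex.sin (k j) + I * u ∉ lams)

omit hu hlams hgen hreg in
/-- Products over a complete duplicate-free ordering of the electrons are products over all.
[folklore] -/
theorem prod_map_complete (c : List (Fin N)) (hc : c.Nodup) (hall : ∀ i, i ∈ c)
    (R : Equiv.Perm (Fin N)) (f : Fin N → ℂ) :
    (c.map fun m => f (R m)).prod = ∏ j, f j := by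
  rw [← List.prod_toFinset (fun m => f (R m)) hc]
  have : c.toFinset = Finset.univ := by
    ext j
    simp [hall j]
  rw [this]
  exact Equiv.prod_comp R f

omit hu hlams hgen hreg in
/-- The vacuum eigenvalue `a(r)` of the chain of all electrons does not depend on the ordering
nor on the assignment `R` of the momenta. [cite: EsslerEtAl2005, eq. (3.B.74)] -/
theorem aEig_chain (c : List (Fin N)) (hc : c.Nodup) (hall : ∀ i, i ∈ c) (R : Equiv.Perm (Fin N))
    (r : ℂ) : aEig (eta u) r (chain u c (inhom k R)) =
      ∏ j, (r - (Complex.sin (k j) + I * u) + eta u) := by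
  unfold aEig chain inhom
  rw [List.map_map]
  exact prod_map_complete c hc hall R (fun j => r - (Complex.sin (k j) + I * u) + eta u)

omit hu hlams hgen hreg in
/-- The vacuum eigenvalue `d(r)` of the chain of all electrons does not depend on the ordering
nor on the assignment `R` of the momenta. [cite: EsslerEtAl2005, eq. (3.B.74)] -/
theorem dEig_chain (c : List (Fin N)) (hc : c.Nodup) (hall : ∀ i, i ∈ c) (R : Equiv.Perm (Fin N))
    (r : ℂ) : dEig r (chain u c (inhom k R)) = ∏ j, (r - (Complex.sin (k j) + I * u)) := by
  unfold dEig chain inhom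
  rw [List.map_map]
  exact prod_map_complete c hc hall R (fun j => r - (Complex.sin (k j) + I * u))

include hu hlams hgen hreg in
/-- **Cyclic transport of an electron around the ring** (Essler et al. (3.B.41) with
(3.B.85)–(3.B.87)): under the Lieb–Wu equations — the spin equations (3.96) in the divided form
of `InhomXXX.coefA_eq_coefD_of_bethe` for the chain of all electrons with inhomogeneities
`sin k_j + iu`, and the charge equations (3.95) in the form
`e^{ik_jL} ∏_μ (sin k_j - μ - iu)/(sin k_j - μ + iu) = 1` — moving the electron `p` from the
bottom of a complete ordering `c ++ [p]` to its top while translating it by `L` does not change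
`ψ`: `ψ_{p :: c}(x + L e_p) = ψ_{c ++ [p]}(x)`.
[cite: EsslerEtAl2005, eqs. (3.B.41), (3.B.85)–(3.B.87)] -/
theorem psiOrd_cycle (Lr : ℕ)
    (hBethe : ∀ j < lams.length,
      (∏ i : Fin N, (lams.getD j 0 - (Complex.sin (k i) + I * u) + eta u)) *
          ((lams.eraseIdx j).map fun nu => (lams.getD j 0 - nu - eta u) / (lams.getD j 0 - nu)).prod =
        (∏ i : Fin N, (lams.getD j 0 - (Complex.sin (k i) + I * u))) *
          ((lams.eraseIdx j).map fun nu => (lams.getD j 0 - nu + eta u) / (lams.getD j 0 - nu)).prod)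
    (hLW : ∀ j : Fin N, Complex.exp (I * k j * Lr) *
      (lams.map fun mu => (Complex.sin (k j) - mu - I * u) / (Complex.sin (k j) - mu + I * u)).prod = 1)
    (c : List (Fin N)) (p : Fin N) (hnd : (c ++ [p]).Nodup) (hall : ∀ i, i ∈ c ++ [p])
    (x : Fin N → ℤ) (a : Fin N → Fin 2) :
    psiOrd u k lams (p :: c) (Function.update x p (x p + Lr)) a = psiOrd u k lams (c ++ [p]) x a := by
  have hη : eta u ≠ 0 := by
    unfold eta
    exact mul_ne_zero (mul_ne_zero two_ne_zero Complex.I_ne_zero) hu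
  unfold psiOrd
  refine Finset.sum_congr rfl fun R _ => ?_
  -- the spin amplitudes of the two orderings
  set s : ℂ := Complex.sin (k (R p)) + I * u with hs
  have hchain1 : chain u (p :: c) (inhom k R) = (p, s) :: chain u c (inhom k R) := rfl
  have hchain2 : chain u (c ++ [p]) (inhom k R) = chain u c (inhom k R) ++ [(p, s)] := by
    rw [chain_append]; rfl
  have hsites : ((chain u c (inhom k R) ++ [(p, s)]).map Prod.fst).Nodup := by
    rw [← hchain2, map_fst_chain]; exact hnd
  have hsl : s ∉ lams := hreg (R p)
  have hgen' : ∀ q ∈ chain u c (inhom k R), s - q.2 + eta u ≠ 0 := by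
    intro q hq
    obtain ⟨m, -, rfl⟩ := List.mem_map.1 hq
    simp only [hs, inhom]
    rw [show Complex.sin (k (R p)) + I * u - (Complex.sin (k (R m)) + I * u) + eta u =
      Complex.sin (k (R p)) - Complex.sin (k (R m)) + eta u by ring]
    exact hgen (R p) (R m)
  have hBethe' : ∀ j < lams.length,
      coefA (eta u) (chain u c (inhom k R) ++ [(p, s)]) (lams.getD j 0) (lams.eraseIdx j) =
        coefD (eta u) (chain u c (inhom k R) ++ [(p, s)]) (lams.getD j 0) (lams.eraseIdx j) := by
    intro j hj
    rw [coefA, coefD, ← hchain2, aEig_chain u k _ hnd hall R, dEig_chain u k _ hnd hall R]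
    exact hBethe j hj
  have hcyc := bString_vac_cycle (eta u) hη p s (chain u c (inhom k R)) hsites lams hlams hsl hgen' hBethe'
  have hamp : amp u lams (p :: c) (inhom k R) a =
      (lams.map fun mu => (s - mu - eta u) / (s - mu)).prod * amp u lams (c ++ [p]) (inhom k R) a := by
    unfold amp
    rw [hchain1, hchain2, hcyc, Pi.smul_apply, smul_eq_mul]
  -- the plane waves
  rw [planeWave_update, hamp]
  have hphase : Complex.exp (I * (k (R p) * (((x p + Lr : ℤ) : ℂ) - x p))) *
      (lams.map fun mu => (s - mu - eta u) / (s - mu)).prod = 1 := by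
    have := hLW (R p)
    push_cast
    rw [show I * (k (R p) * ((x p : ℂ) + Lr - x p)) = I * k (R p) * Lr by ring]
    convert this using 3
    refine List.map_congr_left fun mu _ => ?_
    simp only [hs, eta]
    congr 1 <;> ring
  linear_combination (((Equiv.Perm.sign R : ℤ) : ℂ) * planeWave k R x * amp u lams (c ++ [p]) (inhom k R) a) *
    hphase

include hu hlams hgen hreg in
/-- **Periodicity of `ψ`** (Essler et al. (3.17), (3.B.37)–(3.B.38)): under the Lieb–Wu equations,
translating the leftmost electron by `L` to the right of all others does not change the wave
function. [cite: EsslerEtAl2005, eqs. (3.17), (3.B.37)–(3.B.41)] -/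
theorem psi_periodic (Lr : ℕ)
    (hBethe : ∀ j < lams.length,
      (∏ i : Fin N, (lams.getD j 0 - (Complex.sin (k i) + I * u) + eta u)) *
          ((lams.eraseIdx j).map fun nu => (lams.getD j 0 - nu - eta u) / (lams.getD j 0 - nu)).prod =
        (∏ i : Fin N, (lams.getD j 0 - (Complex.sin (k i) + I * u))) *
          ((lams.eraseIdx j).map fun nu => (lams.getD j 0 - nu + eta u) / (lams.getD j 0 - nu)).prod)
    (hLW : ∀ j : Fin N, Complex.exp (I * k j * Lr) *
      (lams.map fun mu => (Complex.sin (k j) - mu - I * u) / (Complex.sin (k j) - mu + I * u)).prod = 1)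
    (x : Fin N → ℤ) (p : Fin N) (hmin : ∀ i, x p ≤ x i) (hmax : ∀ i, x i ≤ x p + Lr)
    (a : Fin N → Fin 2) :
    psi u k lams (Function.update x p (x p + Lr)) a = psi u k lams x a := by
  set c₀ := (canon x).erase p with hc₀
  have hc₀nd : c₀.Nodup := (canon_nodup x).erase p
  have hpc₀ : p ∉ c₀ := (canon_nodup x).not_mem_erase
  have hmemc₀ : ∀ i, i ≠ p → i ∈ c₀ := fun i hi => (List.mem_erase_of_ne hi).2 (mem_canon x i)
  have hc₀s : c₀.Pairwise (fun i j => x j ≤ x i) := (canon_sorted x).sublist List.erase_sublist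
  -- `c₀ ++ [p]` is a sorted complete ordering for `x`, `p :: c₀` one for the translate
  have hnd1 : (c₀ ++ [p]).Nodup := by
    rw [List.nodup_append]
    exact ⟨hc₀nd, List.nodup_singleton p, fun i hi j hj => by
      rw [List.mem_singleton.1 hj]; exact ne_of_mem_of_not_mem hi hpc₀⟩
  have hall1 : ∀ i, i ∈ c₀ ++ [p] := by
    intro i
    by_cases hi : i = p
    · subst hi; simp
    · exact List.mem_append_left _ (hmemc₀ i hi)
  have hs1 : (c₀ ++ [p]).Pairwise (fun i j => x j ≤ x i) := by
    rw [List.pairwise_append]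
    exact ⟨hc₀s, List.pairwise_singleton _ _, fun i _ j hj => by
      rw [List.mem_singleton.1 hj]; exact hmin i⟩
  have hnd2 : (p :: c₀).Nodup := List.nodup_cons.2 ⟨hpc₀, hc₀nd⟩
  have hall2 : ∀ i, i ∈ p :: c₀ := by
    intro i
    by_cases hi : i = p
    · subst hi; simp
    · exact List.mem_cons_of_mem _ (hmemc₀ i hi)
  have hs2 : (p :: c₀).Pairwise (fun i j => Function.update x p (x p + Lr) j ≤ Function.update x p (x p + Lr) i) := by
    rw [List.pairwise_cons]
    refine ⟨fun i hi => ?_, hc₀s.imp_of_mem fun {i j} hi hj hij => ?_⟩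
    · rw [Function.update_self, Function.update_of_ne (ne_of_mem_of_not_mem hi hpc₀)]
      exact hmax i
    · rwa [Function.update_of_ne (ne_of_mem_of_not_mem hi hpc₀),
        Function.update_of_ne (ne_of_mem_of_not_mem hj hpc₀)]
  rw [psi_eq_psiOrd u k lams hgen _ (p :: c₀) hnd2 hall2 hs2 a,
    psi_eq_psiOrd u k lams hgen x (c₀ ++ [p]) hnd1 hall1 hs1 a]
  exact psiOrd_cycle u hu k lams hlams hgen hreg Lr hBethe hLW c₀ p hnd1 hall1 x a

end Periodic

/-! ### Support: `ψ(x; a) = 0` unless `a` has exactly `M` down spins -/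

/-- The amplitudes vanish unless the spin configuration has exactly `M = |λ⃗|` down spins.
[cite: EsslerEtAl2005, §3.3 after eq. (3.94)] -/
theorem amp_eq_zero_of_downCount (u : ℂ) (lams : List ℂ) (c : List (Fin N)) (t : Fin N → ℂ)
    (b : Fin N → Fin 2) (hb : downCount b ≠ lams.length) : amp u lams c t b = 0 :=
  bString_vac_apply_eq_zero (eta u) (chain u c t) lams b hb

/-- **`ψ` lies in the sector `S^z = (N - 2M)/2`**: `ψ(x; a) = 0` unless `a` has exactly `M` down
spins (Essler et al. (3.100); "If the number of down spins … is different from `M`, the amplitude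
vanishes", §3.3 after (3.94)). [cite: EsslerEtAl2005, eq. (3.100)] -/
theorem psi_eq_zero_of_downCount (u : ℂ) (k : Fin N → ℂ) (lams : List ℂ) (x : Fin N → ℤ)
    (a : Fin N → Fin 2) (ha : downCount a ≠ lams.length) : psi u k lams x a = 0 := by
  unfold psi psiOrd
  exact Finset.sum_eq_zero fun R _ => by rw [amp_eq_zero_of_downCount u lams _ _ a ha, mul_zero]

end HubbardBA

end Literature.MathematicalPhysics.QuantumLattice
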